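import Literature.Probability.LatticeModels.LatticeWalkWinding
import Literature.Probability.LatticeModels.DomainDiscretisation
import Literature.Topology.PlaneTopology.JordanNesting
import HarnessLib

/-!
# The closed loop of the shielding lemma: its polygon and the vanishing of its winding number

Sub-problem `CriticalPhenomena/SAWScalingLimit`, crux `AvoidanceLimit`, line `symplectic-fermion-anchor`
(lead c5, §shield). The loop `λ = In · γ · Far · L̂⁻¹` of the shielding lemma is a closed walk of the
discrete domain graph `Ω^δ = discreteDomainGraph D.carrier δ`; its polygon (rescaled by the mesh
`δ`) lies in the closure `D̄` — edges of `Ω^δ` are closed segments in `D̄` — and may TOUCH `∂D`.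
We record:

* `walkPath_mapLe` — the polygon of a walk read in a supergraph is the same path;
* `smul_mem_closure_of_mem_range_walkPath` — for a walk of `Ω^δ` starting at a site whose mesh
  point lies in `Ω̄`, `δ · z ∈ Ω̄` for every point `z` of its polygon;
* `wind_walkPath_sub_eq_zero_of_smul_not_mem` — **the polygon of a closed walk of `D^δ` does not
  wind about the points `q` off the polygon with `δ q ∉ D`** (`D` a Jordan domain): `δ q` lies on
  the boundary loop or outside it; the outside of the boundary loop is connected
  (`IsJordanLoop.isPreconnected_outside`), accumulates at every boundary point
  (`IsJordanLoop.frontier_outside`), misses the rescaled polygon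
  (`JordanDomain.outside_boundary_eq_compl_closure`) and contains points far to the right, about
  which the winding number vanishes; the winding number is constant on the component of the
  complement of the polygon containing all these points (`wind_sub_eq_of_mem_connectedComponentIn`).

All statements are [folklore].
-/

noncomputable section

open scoped BigOperators Classical
open Set Complex SimpleGraph Metric
open Literature.Topology.PlaneTopology
open Literature.Probability.LatticeModels
open Literature.Probability.RandomPlanarGeometry

namespace Summit.CriticalPhenomena.SAWScalingLimit.Theorems.AvoidanceLimit.Anchor

/-! ### The polygon of a walk read in a supergraph -/

/-- The polygon of a walk mapped into a supergraph is the polygon of the walk. [folklore] -/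
theorem walkPath_mapLe {G G' : SimpleGraph (Site 2)} (h : G ≤ G') :
    ∀ {a b : Site 2} (p : G.Walk a b), walkPath (p.mapLe h) = walkPath p := by
  intro a b p
  induction p with
  | nil => rfl
  | cons h' p ih =>
    show (Path.segment _ _).trans (walkPath (p.mapLe h)) = (Path.segment _ _).trans (walkPath p)
    rw [ih]

/-! ### The rescaled polygon of a walk of the discrete domain lies in the closure -/

/-- **Edges of `Ω^δ` are closed segments of `Ω̄`**: for a walk of `discreteDomainGraph Ω δ` whose
start has its mesh point in `Ω̄`, every point `z` of the polygon satisfies `δ · z ∈ Ω̄`. [folklore] -/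
theorem smul_mem_closure_of_mem_range_walkPath :
    ∀ (Ω : Set ℂ) (δ : ℝ) {a b : Site 2} (p : (discreteDomainGraph Ω δ).Walk a b),
      meshPoint δ a ∈ closure Ω → ∀ z ∈ range (walkPath p), (δ : ℂ) * z ∈ closure Ω := by
  intro Ω δ a b p ha z hz
  induction p with
  | nil =>
    rw [walkPath_nil, Path.refl_range, mem_singleton_iff] at hz
    subst hz
    exact ha
  | cons h p ih =>
    rename_i x y w
    rw [walkPath_cons, Path.trans_range, mem_union, Path.range_segment] at hz
    have hadj := discreteDomainGraph_adj_iff.1 h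
    have hseg : segment ℝ (meshPoint δ x) (meshPoint δ y) ⊆ closure Ω := (meshGraph_adj_iff.1 hadj.1).2
    have hy : meshPoint δ y ∈ closure Ω := subset_closure (meshDomain_subset_meshVertices _ _ hadj.2.2)
    rcases hz with hz | hz
    · -- on the first edge: `δ z` lies on the segment of mesh points
      apply hseg
      rw [segment_eq_image_lineMap] at hz ⊢
      obtain ⟨t, ht, rfl⟩ := hz
      refine ⟨t, ht, ?_⟩
      simp only [meshPoint, AffineMap.lineMap_apply_module, Complex.real_smul]
      ring
    · exact ih hy hz

/-! ### The winding number of a closed walk of `D^δ` about points off `D` -/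

/-- **A closed polygon of `D̄` does not wind about points of `ℂ ∖ D` off the polygon.** Let `D` be a
Jordan domain, `δ > 0`, and `p` a closed lattice walk whose rescaled polygon `δ · walkPath p` lies
in `D̄`. Then for every `q` off the polygon with `δ q ∉ D` the winding number of the polygon about
`q` vanishes. [folklore] -/
theorem wind_walkPath_sub_eq_zero_of_smul_not_mem :
    ∀ (D : JordanDomain) (δ : ℝ), 0 < δ → ∀ {a : Site 2} (p : (zdGraph 2).Walk a a),
      (∀ z ∈ range (walkPath p), (δ : ℂ) * z ∈ closure D.carrier) →
      ∀ q : ℂ, (δ : ℂ) * q ∉ D.carrier → q ∉ range (walkPath p) →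
        wind (fun t => (walkPath p).extend t - q) = 0 := by
  intro D δ hδ a p hp q hqD hq
  have hδ0 : (δ : ℂ) ≠ 0 := by exact_mod_cast hδ.ne'
  set P : Path (Site.toComplex a) (Site.toComplex a) := walkPath p with hP
  -- the rescaled loop `L = δ · P`
  set L : ℝ → ℂ := fun t => (δ : ℂ) * P.extend t with hL
  have hLcont : ContinuousOn L (Icc 0 1) := (continuous_const.mul P.continuous_extend).continuousOn
  have hL01 : L 0 = L 1 := by simp [hL]
  have hLrange : ∀ t, L t ∈ (fun z => (δ : ℂ) * z) '' range P := fun t =>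
    ⟨P.extend t, by
      rcases le_total t 0 with ht | ht
      · rw [Path.extend_of_le_zero _ ht]; exact ⟨0, P.source⟩
      rcases le_total 1 t with ht' | ht'
      · rw [Path.extend_of_one_le _ ht']; exact ⟨1, P.target⟩
      · rw [Path.extend_apply _ ⟨ht, ht'⟩]; exact mem_range_self _, rfl⟩
  have hLK : MapsTo L (Icc 0 1) (closure D.carrier) := by
    intro t _
    obtain ⟨z, hz, hzL⟩ := hLrange t
    rw [← hzL]; exact hp z hz
  -- winding about `q` equals winding of the rescaled loop about `δ q`
  have hscale : wind (fun t => P.extend t - q) = wind (fun t => L t - (δ : ℂ) * q) := by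
    have hne : ∀ t ∈ Icc (0 : ℝ) 1, P.extend t - q ≠ 0 := by
      intro t ht h
      apply hq
      rw [sub_eq_zero] at h
      rw [← h, Path.extend_apply _ ht]; exact mem_range_self _
    have hf : IsNonvanishingLoop (fun t => P.extend t - q) :=
      ⟨(P.continuous_extend.sub continuous_const).continuousOn, hne, by simp⟩
    have hc : IsNonvanishingLoop (fun _ : ℝ => (δ : ℂ)) :=
      ⟨continuousOn_const, fun _ _ => hδ0, rfl⟩
    have e : (fun t => L t - (δ : ℂ) * q) = fun t => (δ : ℂ) * (P.extend t - q) := by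
      funext t; simp [hL]; ring
    rw [e, show (fun t => (δ : ℂ) * (P.extend t - q)) = fun t => (fun _ : ℝ => (δ : ℂ)) t * (P.extend t - q)
      from rfl, wind_mul hc hf, wind_const, zero_add]
  rw [hscale]
  -- the compact set carrying the rescaled loop
  set K : Set ℂ := (fun z => (δ : ℂ) * z) '' range P with hK
  have hKc : IsCompact K := (isCompact_range P.continuous).image (continuous_const.mul continuous_id)
  have hLK' : MapsTo L (Icc 0 1) K := fun t _ => hLrange t
  have hqK : (δ : ℂ) * q ∉ K := by
    rintro ⟨z, hz, hzq⟩
    have : z = q := mul_left_cancel₀ hδ0 hzq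
    exact hq (this ▸ hz)
  -- a far point `r`: to the right of `K` and outside the closure of `D`
  obtain ⟨RK, hRK⟩ := hKc.isBounded.subset_closedBall 0
  obtain ⟨RD, hRD⟩ := D.isBounded.subset_closedBall 0
  set r : ℂ := ((|RK| + |RD| + 1 : ℝ) : ℂ) with hr
  have hrre : r.re = |RK| + |RD| + 1 := by simp [hr]
  have hrfar : ∀ z ∈ K, z.re < r.re := by
    intro z hz
    have h1 : ‖z‖ ≤ RK := by simpa using hRK hz
    have h2 : z.re ≤ ‖z‖ := Complex.re_le_norm z
    rw [hrre]; linarith [le_abs_self RK, abs_nonneg RD]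
  have hwr : wind (fun t => L t - r) = 0 := by
    refine wind_comp_eq_zero_of_hasLogOn (hasLogOn_sub_of_re_lt r) (γ := L) hLcont (fun t ht => ?_) hL01
    exact hrfar _ (hLK' ht)
  have hrD : r ∉ closure D.carrier := by
    intro h
    have hcl : closure D.carrier ⊆ closedBall (0 : ℂ) RD := closure_minimal hRD isClosed_closedBall
    have h1 : ‖r‖ ≤ RD := by simpa using hcl h
    have h2 : ‖r‖ = |RK| + |RD| + 1 := by
      rw [hr, Complex.norm_real, Real.norm_eq_abs, abs_of_pos (by positivity)]
    linarith [le_abs_self RD, abs_nonneg RK]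
  -- the outside of the boundary loop: connected, inside `Kᶜ`, containing `r`
  have hJ := D.isJordanLoop_boundary
  have hout : IsJordanLoop.outside D.boundary = (closure D.carrier)ᶜ := D.outside_boundary_eq_compl_closure
  have hKsub : K ⊆ closure D.carrier := by
    rintro _ ⟨z, hz, rfl⟩; exact hp z hz
  have houtK : IsJordanLoop.outside D.boundary ⊆ Kᶜ := by
    rw [hout]; exact compl_subset_compl.2 hKsub
  have hrout : r ∈ IsJordanLoop.outside D.boundary := by rw [hout]; exact hrD
  have hcomp : IsJordanLoop.outside D.boundary ⊆ connectedComponentIn Kᶜ r :=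
    hJ.isPreconnected_outside.subset_connectedComponentIn hrout houtK
  -- `δ q` lies in the component of `Kᶜ` containing `r`
  have hqcomp : (δ : ℂ) * q ∈ connectedComponentIn Kᶜ r := by
    by_cases hqo : (δ : ℂ) * q ∈ IsJordanLoop.outside D.boundary
    · exact hcomp hqo
    · -- `δ q` is a boundary point of `D`, hence in the closure of the outside
      have hqfr : (δ : ℂ) * q ∈ frontier D.carrier := by
        rw [hout, mem_compl_iff, not_not] at hqo
        rw [frontier, D.isOpen.interior_eq]
        exact ⟨hqo, hqD⟩
      have hqcl : (δ : ℂ) * q ∈ closure (IsJordanLoop.outside D.boundary) := by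
        rw [← D.range_boundary, ← hJ.frontier_outside] at hqfr
        exact frontier_subset_closure hqfr
      -- a small ball about `δ q` inside the open set `Kᶜ`
      have hKo : IsOpen Kᶜ := hKc.isClosed.isOpen_compl
      obtain ⟨ε, hε, hball⟩ := Metric.isOpen_iff.1 hKo _ hqK
      obtain ⟨o₁, ho₁b, ho₁o⟩ : (Metric.ball ((δ : ℂ) * q) ε ∩ IsJordanLoop.outside D.boundary).Nonempty :=
        Metric.mem_closure_iff.1 hqcl ε hε |> fun ⟨y, hyo, hyd⟩ => ⟨y, by rw [Metric.mem_ball, _root_.dist_comm]; exact hyd, hyo⟩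
      have ho₁ : o₁ ∈ connectedComponentIn Kᶜ r := hcomp ho₁o
      have hballsub : Metric.ball ((δ : ℂ) * q) ε ⊆ connectedComponentIn Kᶜ o₁ :=
        (convex_ball _ _).isPreconnected.subset_connectedComponentIn ho₁b hball
      rw [← connectedComponentIn_eq ho₁] at hballsub
      exact hballsub (Metric.mem_ball_self hε)
  rw [← wind_sub_eq_of_mem_connectedComponentIn hLcont hL01 hKc.isClosed hLK' hqcomp]
  exact hwr

end Summit.CriticalPhenomena.SAWScalingLimit.Theorems.AvoidanceLimit.Anchor

end
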